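import Mathlib
import Summits.Ventures.HodgeRepro2.DoubleCosetMem

/-!
# NonVanishingSelfAdjointHodgePeriod — the (N)-period chain closed on ONE self-adjoint Hecke
operator, at the level of forms and Hodge periods

Blind cell `pub-hodge-repro2`, seat p2 (Tier 5 kernel support).

The end of the Hecke side of the (N)-period argument, with no commutativity hypothesis: from a
Tier-3 input and any rational unitary `δ` with `δ⁻¹ ∈ S'δS'`, a HOLOMORPHIC weight-`3` form `g`
for `S'` (a function on the ball, not a class) which is a `T_δ`-eigenform with REAL eigenvalue and
whose Hodge period against the vertex form `f` is non-zero: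
`∫_{D} ω_f ∧ conj ω_g ≠ 0` (`= 4 ⟨g, f⟩_Pet` by `MultiplicityOnePeriod.lean`).

* **`NonVanishingInput.exists_hecke_eigenform_hodgePeriod_ne_zero`**.
-/

namespace Summit.Ventures.HodgeRepro2.ShimuraData

open MeasureTheory

variable {K : Type*} [Field K] [NumberField K] [NumberField.IsCMField K] {τ₁ : K →+* ℂ}
  {H : Matrix (Fin 3) (Fin 3) K} {Q : Matrix (Fin 3) (Fin 3) ℂ} {𝔪 : Submodule ℤ (Fin 3 → K)}

/-- **A holomorphic `T_δ`-eigenform with real eigenvalue and non-zero Hodge period against the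
vertex form, from a Tier-3 input and `δ⁻¹ ∈ S'δS'`.** -/
theorem NonVanishingInput.exists_hecke_eigenform_hodgePeriod_ne_zero (hH : IsHermitianForm K H)
    (hdef : ∀ τ : K →+* ℂ, NumberField.InfinitePlace.mk τ ≠ NumberField.InfinitePlace.mk τ₁ →
      IsDefiniteAt K τ H)
    (hQ : IsFrame K τ₁ H Q) (h𝔪 : IsLattice K 𝔪) (hnv : NonVanishingInput K τ₁ H 𝔪 Q) {N : ℕ}
    (hN : 2 < N)
    [CompactSpace (ballQuotient hQ (shimuraLevelSubgroup K H 𝔪 1)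
      (shimuraLevelSubgroup_one_subset_unitaryGroup H 𝔪))] :
    ∃ S' : Subgroup (GL (Fin 3) K), ∃ hS' : (S' : Set (GL (Fin 3) K)) ⊆ shimuraLevel K H 𝔪 N,
      IsTorsionFreeSet K (S' : Set (GL (Fin 3) K)) ∧
      ∃ hS₁ : S' ≤ shimuraLevelSubgroup K H 𝔪 1,
      ∃ hfin : (S'.subgroupOf (shimuraLevelSubgroup K H 𝔪 1)).FiniteIndex,
      ∃ _hc : CompactSpace (ballQuotient hQ S' (subset_unitaryGroup_of_subset_shimuraLevel hS')),
      ∃ D : Set ball₂, ∃ hDm : MeasurableSet D,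
      ∃ hD : IsBallFundamentalDomain hQ S' (subset_unitaryGroup_of_subset_shimuraLevel hS') D,
      ∃ f : PeterssonForms hQ S' (subset_unitaryGroup_of_subset_shimuraLevel hS') 3 hD,
        f ∈ holomorphicForms hQ S' _ 3 hD ∧
        (SeparationQuotient.mk f : PeterssonSpace hQ S' _ 3 hD) ≠ 0 ∧
        ∀ δ : unitaryGroup K H, (δ : GL (Fin 3) K)⁻¹ ∈ doubleCoset S' (δ : GL (Fin 3) K) →
          ∃ g : PeterssonForms hQ S' _ 3 hD, g ∈ holomorphicForms hQ S' _ 3 hD ∧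
            (∃ r : ℝ, heckeFamilyOf hQ S' _ 3 hD hDm
              (fun δ => fintypeHeckeQuotientOfFiniteIndex h𝔪 hS₁ hfin δ.2) δ
                (SeparationQuotient.mk g)
              = (r : ℂ) • (SeparationQuotient.mk g : PeterssonSpace hQ S' _ 3 hD)) ∧
            ∫ x in Subtype.val '' D, hodgeWedge (PeterssonForms.toForm hQ S' _ 3 hD f)
                (PeterssonForms.toForm hQ S' _ 3 hD g) x ≠ 0 := by
  obtain ⟨S', hS', htf, hS₁, hfin, hc, D, hDm, hD, f, hfhol, hfne, hmain⟩ :=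
    hnv.exists_hecke_eigenform_real_of_inv_mem_doubleCoset hH hdef hQ h𝔪 hN
  refine ⟨S', hS', htf, hS₁, hfin, hc, D, hDm, hD, f, hfhol, hfne, fun δ hmem => ?_⟩
  obtain ⟨v, hv, _hnorm, ⟨r, hr⟩, hinner⟩ := hmain δ hmem
  haveI := hc
  -- a holomorphic representative of `v`
  set vh : holomorphicSpace hQ S' (subset_unitaryGroup_of_subset_shimuraLevel hS') 3 hD :=
    ⟨v, hv⟩ with hvh
  set g := holRep hQ S' (subset_unitaryGroup_of_subset_shimuraLevel hS') 3 hD vh with hg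
  have hmk : (SeparationQuotient.mk g : PeterssonSpace hQ S' _ 3 hD) = v :=
    mk_holRep hQ S' (subset_unitaryGroup_of_subset_shimuraLevel hS') 3 hD vh
  refine ⟨g, holRep_mem hQ S' _ 3 hD vh, ⟨r, ?_⟩, ?_⟩
  · rw [hmk]
    exact hr
  · rw [setIntegral_hodgeWedge_eq_inner_mk hQ S' (subset_unitaryGroup_of_subset_shimuraLevel hS')
      hD hDm f g, hmk]
    exact mul_ne_zero (by norm_num) hinner

end Summit.Ventures.HodgeRepro2.ShimuraData
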